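import Mathlib
import HarnessLib

/-!
# Crux `PoloidalLiouville` (stmt-NavierStokesRegularity-1222, wall W1), crux idea «horizon-threading-tower» (ns-idea-15):
# ALL-DEGREE horizon zonality, kernel part F5a — the complex-coordinate polynomial algebra (weights, `Δ̃`, `D̃`, jets)

Support file (Theorems-side tooling; seat ns-wall-eng-5 g4, cell ns-wall-extremal, W1 adjunct; `--supports stmt-NavierStokesRegularity-1222
--as helper`).  Memo of record: pub/ns-wall-extremal/ARM-B/zonal-eng5/PROOF-HZSD-ALL-L.md (DATUM B-w5.8): a uniform proof, for every degree
`l`, that a real degree-`l` solid harmonic `H` with `det(∇H, ∇|∇H|², x) ≡ 0` is zonal — which by `horizonZonalitySingleDegree_of_detZonal`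
(p673002) is the typed obstruction `HorizonTower.HorizonZonalitySingleDegree` BY NAME.  This file is the ALGEBRAIC SETTING of that proof:
polynomials in the complex coordinates `(W, V, Z) = (w, w̄, z)` about an axis (`w = x₁ + i x₂`), i.e. `MvPolynomial (Fin 3) ℂ` with the
ℤ-grading by the azimuthal WEIGHT `wt = (1, −1, 0)`; the transported Laplacian `lapC = 4 ∂_W ∂_V + ∂_Z²`, bilinear gradient pairing
`dotC`, weight operator `lam = W∂_W − V∂_V` and triple product `tripleC A B = B_Z·ΛA − A_Z·ΛB + 2Z(A_V B_W − A_W B_V)`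
(`= −i·det(∇A, ∇B, x)`, memo (1.1)), `detC Q = tripleC Q (dotC Q Q)`; their weight bookkeeping; and the JET LEMMA
`eval_axisPoint`: at the point `(W,V,Z) = (1,0,1)` a polynomial of weight `μ` and degree `n` evaluates to its single admissible
coefficient.  No analysis, no NS statement.  HONEST LABEL: tooling toward a crux-idea lemma; `PoloidalLiouville` (1222),
`UnthreadedRigidity` (27585), `HorizonZonalitySingleDegree` (until the assembly lands) and NS regularity remain OPEN; W1/W2 movement 0.
[folklore] (multivariate polynomial calculus).
-/

-- the summit and its single problem share the name (D-0017 nested layout)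
set_option linter.dupNamespace false

noncomputable section

open MvPolynomial Finsupp

namespace Summit.NavierStokesRegularity.NavierStokesRegularity.Theorems.PoloidalLiouville.HorizonTower.Zonal

/-- Polynomials in the three complex coordinates `W = w = x₁ + i x₂`, `V = w̄`, `Z = z = x₃` (variables `0, 1, 2`). -/
abbrev CPoly : Type := MvPolynomial (Fin 3) ℂ

/-- The azimuthal WEIGHT of the variables: `W ↦ 1`, `V ↦ −1`, `Z ↦ 0` (a monomial `W^a V^b Z^c` has weight `a − b`, the
eigenvalue of `−i∂_φ`). -/
def wt : Fin 3 → ℤ := ![1, -1, 0]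

/-- `W` has weight `1`. [folklore] -/
@[simp] theorem wt_zero : wt 0 = 1 := rfl
/-- `V` has weight `−1`. [folklore] -/
@[simp] theorem wt_one : wt 1 = -1 := rfl
/-- `Z` has weight `0`. [folklore] -/
@[simp] theorem wt_two : wt 2 = 0 := rfl

/-- The Laplacian in complex coordinates: `Δ = 4 ∂_W ∂_V + ∂_Z²` (memo §1). -/
def lapC (Q : CPoly) : CPoly := C (4 : ℂ) * pderiv 0 (pderiv 1 Q) + pderiv 2 (pderiv 2 Q)

/-- The BILINEAR (no conjugation) gradient pairing in complex coordinates: `∇A·∇B = 2(A_W B_V + A_V B_W) + A_Z B_Z`. -/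
def dotC (A B : CPoly) : CPoly := C (2 : ℂ) * (pderiv 0 A * pderiv 1 B + pderiv 1 A * pderiv 0 B) + pderiv 2 A * pderiv 2 B

/-- The weight operator `Λ = W ∂_W − V ∂_V` (`= −i` times the rotation generator `x₁∂₂ − x₂∂₁`). -/
def lam (A : CPoly) : CPoly := X 0 * pderiv 0 A - X 1 * pderiv 1 A

/-- The transported triple product: `tripleC A B = B_Z ΛA − A_Z ΛB + 2 Z (A_V B_W − A_W B_V) = −i · det(∇A, ∇B, x)` (memo (1.1)). -/
def tripleC (A B : CPoly) : CPoly :=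
  pderiv 2 B * lam A - pderiv 2 A * lam B + C (2 : ℂ) * X 2 * (pderiv 1 A * pderiv 0 B - pderiv 0 A * pderiv 1 B)

/-- `D̃(Q) = tripleC Q (∇Q·∇Q)` — the transported `−i·det(∇H, ∇|∇H|², x)`, a cubic form in `Q`. -/
def detC (Q : CPoly) : CPoly := tripleC Q (dotC Q Q)

/-! ### Weight and degree bookkeeping -/

section Weights

variable {A B : CPoly} {m n : ℤ} {k l : ℕ}

/-- `∂_W` lowers the weight by one. [folklore] -/
theorem isWeightedHomogeneous_pderiv_zero (hA : IsWeightedHomogeneous wt A m) :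
    IsWeightedHomogeneous wt (pderiv 0 A) (m - 1) :=
  hA.pderiv (by simp)

/-- `∂_V` raises the weight by one. [folklore] -/
theorem isWeightedHomogeneous_pderiv_one (hA : IsWeightedHomogeneous wt A m) :
    IsWeightedHomogeneous wt (pderiv 1 A) (m + 1) :=
  hA.pderiv (by simp)

/-- `∂_Z` preserves the weight. [folklore] -/
theorem isWeightedHomogeneous_pderiv_two (hA : IsWeightedHomogeneous wt A m) :
    IsWeightedHomogeneous wt (pderiv 2 A) m :=
  hA.pderiv (by simp)

/-- Negation preserves weighted homogeneity. [folklore] -/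
theorem isWeightedHomogeneous_neg (hA : IsWeightedHomogeneous wt A m) : IsWeightedHomogeneous wt (-A) m :=
  (weightedHomogeneousSubmodule ℂ wt m).neg_mem hA

/-- Subtraction preserves weighted homogeneity. [folklore] -/
theorem isWeightedHomogeneous_sub (hA : IsWeightedHomogeneous wt A m) (hB : IsWeightedHomogeneous wt B m) :
    IsWeightedHomogeneous wt (A - B) m :=
  (weightedHomogeneousSubmodule ℂ wt m).sub_mem hA hB

/-- `W` is weight-homogeneous of weight `1`. [folklore] -/
theorem isWeightedHomogeneous_X_zero : IsWeightedHomogeneous wt (X 0 : CPoly) 1 := by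
  simpa using isWeightedHomogeneous_X (R := ℂ) wt 0

/-- `V` is weight-homogeneous of weight `−1`. [folklore] -/
theorem isWeightedHomogeneous_X_one : IsWeightedHomogeneous wt (X 1 : CPoly) (-1) := by
  simpa using isWeightedHomogeneous_X (R := ℂ) wt 1

/-- `Z` is weight-homogeneous of weight `0`. [folklore] -/
theorem isWeightedHomogeneous_X_two : IsWeightedHomogeneous wt (X 2 : CPoly) 0 := by
  simpa using isWeightedHomogeneous_X (R := ℂ) wt 2

/-- `Λ` preserves the weight. [folklore] -/
theorem isWeightedHomogeneous_lam (hA : IsWeightedHomogeneous wt A m) : IsWeightedHomogeneous wt (lam A) m := by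
  unfold lam
  refine isWeightedHomogeneous_sub ?_ ?_
  · simpa using isWeightedHomogeneous_X_zero.mul (isWeightedHomogeneous_pderiv_zero hA)
  · have h := isWeightedHomogeneous_X_one.mul (isWeightedHomogeneous_pderiv_one hA)
    convert h using 1
    ring

/-- Weights add under the gradient pairing `dotC`. [folklore] -/
theorem isWeightedHomogeneous_dotC (hA : IsWeightedHomogeneous wt A m) (hB : IsWeightedHomogeneous wt B n) :
    IsWeightedHomogeneous wt (dotC A B) (m + n) := by
  unfold dotC
  refine IsWeightedHomogeneous.add ?_ ?_
  · refine (IsWeightedHomogeneous.add ?_ ?_).C_mul _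
    · convert (isWeightedHomogeneous_pderiv_zero hA).mul (isWeightedHomogeneous_pderiv_one hB) using 1
      ring
    · convert (isWeightedHomogeneous_pderiv_one hA).mul (isWeightedHomogeneous_pderiv_zero hB) using 1
      ring
  · exact (isWeightedHomogeneous_pderiv_two hA).mul (isWeightedHomogeneous_pderiv_two hB)

/-- Weights add under the triple product `tripleC`. [folklore] -/
theorem isWeightedHomogeneous_tripleC (hA : IsWeightedHomogeneous wt A m) (hB : IsWeightedHomogeneous wt B n) :
    IsWeightedHomogeneous wt (tripleC A B) (m + n) := by
  unfold tripleC
  refine IsWeightedHomogeneous.add (isWeightedHomogeneous_sub ?_ ?_) ?_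
  · convert (isWeightedHomogeneous_pderiv_two hB).mul (isWeightedHomogeneous_lam hA) using 1
    ring
  · exact (isWeightedHomogeneous_pderiv_two hA).mul (isWeightedHomogeneous_lam hB)
  · have h2 : IsWeightedHomogeneous wt (C (2 : ℂ) * X 2 : CPoly) 0 := isWeightedHomogeneous_X_two.C_mul _
    have h := h2.mul (isWeightedHomogeneous_sub
      ((isWeightedHomogeneous_pderiv_one hA).mul (isWeightedHomogeneous_pderiv_zero hB))
      (by convert (isWeightedHomogeneous_pderiv_zero hA).mul (isWeightedHomogeneous_pderiv_one hB) using 1; ring))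
    convert h using 1
    ring

/-- `D̃` triples the weight. [folklore] -/
theorem isWeightedHomogeneous_detC (hA : IsWeightedHomogeneous wt A m) : IsWeightedHomogeneous wt (detC A) (3 * m) := by
  unfold detC
  convert isWeightedHomogeneous_tripleC hA (isWeightedHomogeneous_dotC hA hA) using 1
  ring

end Weights

/-! ### Exponent bookkeeping on `Fin 3` and the jet lemma at the axis point `(1, 0, 1)` -/

/-- The azimuthal weight of an exponent `d = (a, b, c)` is `a − b`. -/
theorem weight_wt (d : Fin 3 →₀ ℕ) : weight wt d = (d 0 : ℤ) - d 1 := by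
  rw [weight_apply, Finsupp.sum_fintype _ _ (fun i => by simp)]
  simp [Fin.sum_univ_three]
  ring

/-- The `1`-weight (total degree) of an exponent `d = (a, b, c)` is `a + b + c`. -/
theorem weight_one_fin3 (d : Fin 3 →₀ ℕ) : weight (1 : Fin 3 → ℕ) d = d 0 + d 1 + d 2 := by
  rw [weight_apply, Finsupp.sum_fintype _ _ (fun i => by simp)]
  simp [Fin.sum_univ_three]

/-- Support control: a monomial in the support of a weight-`μ`, degree-`n` polynomial has `d₀ − d₁ = μ` and `d₀ + d₁ + d₂ = n`. -/
theorem exponent_of_mem_support {P : CPoly} {μ : ℤ} {n : ℕ} (hw : IsWeightedHomogeneous wt P μ) (hd : P.IsHomogeneous n)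
    {d : Fin 3 →₀ ℕ} (h : d ∈ P.support) : (d 0 : ℤ) - d 1 = μ ∧ d 0 + d 1 + d 2 = n := by
  have hc : coeff d P ≠ 0 := MvPolynomial.mem_support_iff.mp h
  refine ⟨by rw [← weight_wt]; exact hw hc, ?_⟩
  rw [← weight_one_fin3]
  exact hd hc

/-- The evaluation point `(W, V, Z) = (1, 0, 1)` (used purely algebraically: evaluation there keeps exactly the `V`-free monomials,
and a polynomial of fixed weight and degree has at most one of those). -/
def axisPt : Fin 3 → ℂ := ![1, 0, 1]

/-- `W`-coordinate of the axis point is `1`. [folklore] -/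
@[simp] theorem axisPt_zero : axisPt 0 = 1 := rfl
/-- `V`-coordinate of the axis point is `0`. [folklore] -/
@[simp] theorem axisPt_one : axisPt 1 = 0 := rfl
/-- `Z`-coordinate of the axis point is `1`. [folklore] -/
@[simp] theorem axisPt_two : axisPt 2 = 1 := rfl

/-- The exponent `(a, b, c)` of the monomial `W^a V^b Z^c`. -/
def tri (a b c : ℕ) : Fin 3 →₀ ℕ := single 0 a + single 1 b + single 2 c

/-- `W`-exponent of `tri a b c`. [folklore] -/
@[simp] theorem tri_apply_zero (a b c : ℕ) : tri a b c 0 = a := by simp [tri]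
/-- `V`-exponent of `tri a b c`. [folklore] -/
@[simp] theorem tri_apply_one (a b c : ℕ) : tri a b c 1 = b := by simp [tri]
/-- `Z`-exponent of `tri a b c`. [folklore] -/
@[simp] theorem tri_apply_two (a b c : ℕ) : tri a b c 2 = c := by simp [tri]

/-- Every exponent on `Fin 3` is a `tri`. [folklore] -/
theorem eq_tri (d : Fin 3 →₀ ℕ) : d = tri (d 0) (d 1) (d 2) := by
  ext i; fin_cases i <;> simp

/-- `tri` is injective (componentwise equality). [folklore] -/
theorem tri_eq_tri_iff {a b c a' b' c' : ℕ} : tri a b c = tri a' b' c' ↔ a = a' ∧ b = b' ∧ c = c' := by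
  constructor
  · intro h
    exact ⟨by simpa using congrArg (fun d => d 0) h, by simpa using congrArg (fun d => d 1) h,
      by simpa using congrArg (fun d => d 2) h⟩
  · rintro ⟨rfl, rfl, rfl⟩; rfl

/-- Adding to the `W`-exponent. [folklore] -/
@[simp] theorem tri_add_single_zero (a b c n : ℕ) : tri a b c + single 0 n = tri (a + n) b c := by
  ext i; fin_cases i <;> simp
/-- Adding to the `V`-exponent. [folklore] -/
@[simp] theorem tri_add_single_one (a b c n : ℕ) : tri a b c + single 1 n = tri a (b + n) c := by
  ext i; fin_cases i <;> simp
/-- Adding to the `Z`-exponent. [folklore] -/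
@[simp] theorem tri_add_single_two (a b c n : ℕ) : tri a b c + single 2 n = tri a b (c + n) := by
  ext i; fin_cases i <;> simp

/-- Degree of `tri a b c` is `a + b + c`. [folklore] -/
theorem degree_tri (a b c : ℕ) : (tri a b c).degree = a + b + c := by
  rw [degree_eq_sum, Fin.sum_univ_three, tri_apply_zero, tri_apply_one, tri_apply_two]

/-- Weight of `tri a b c` is `a − b`. [folklore] -/
theorem weight_wt_tri (a b c : ℕ) : weight wt (tri a b c) = (a : ℤ) - b := by
  rw [weight_wt, tri_apply_zero, tri_apply_one]

/-- The admissible exponent of weight `μ` and degree `n` with no `V`: `(μ, 0, n − μ)` (junk-truncated when inadmissible). -/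
def axisExp (μ : ℤ) (n : ℕ) : Fin 3 →₀ ℕ := tri μ.toNat 0 (n - μ.toNat)

/-- `W`-exponent of the admissible exponent. [folklore] -/
@[simp] theorem axisExp_zero (μ : ℤ) (n : ℕ) : axisExp μ n 0 = μ.toNat := by simp [axisExp]
/-- `V`-exponent of the admissible exponent (zero). [folklore] -/
@[simp] theorem axisExp_one (μ : ℤ) (n : ℕ) : axisExp μ n 1 = 0 := by simp [axisExp]
/-- `Z`-exponent of the admissible exponent. [folklore] -/
@[simp] theorem axisExp_two (μ : ℤ) (n : ℕ) : axisExp μ n 2 = n - μ.toNat := by simp [axisExp]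

/-- **Jet lemma.**  At the axis point `(1, 0, 1)` a polynomial of weight `μ` and degree `n` evaluates to its coefficient at the single
admissible `V`-free exponent `(μ, 0, n − μ)`. [folklore] -/
theorem eval_axisPt {P : CPoly} {μ : ℤ} {n : ℕ} (hw : IsWeightedHomogeneous wt P μ) (hd : P.IsHomogeneous n) :
    eval axisPt P = coeff (axisExp μ n) P := by
  classical
  rw [eval_eq']
  rw [Finset.sum_eq_single (axisExp μ n)]
  · simp [Fin.prod_univ_three]
  · intro d hd' hne
    by_cases h1 : d 1 = 0
    · exfalso
      apply hne
      obtain ⟨hwd, hdd⟩ := exponent_of_mem_support hw hd hd'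
      ext i
      fin_cases i
      · simp only [Fin.zero_eta, axisExp_zero]
        omega
      · simp only [Fin.mk_one, axisExp_one, h1]
      · simp only [Fin.reduceFinMk, axisExp_two]
        omega
    · simp [Fin.prod_univ_three, zero_pow h1]
  · intro hnot
    simp [MvPolynomial.notMem_support_iff.mp hnot]

/-- Jet lemma, natural weight: `P(1,0,1) = coeff (μ, 0, n − μ) P`. -/
theorem eval_axisPt_nat {P : CPoly} {μ n : ℕ} (hw : IsWeightedHomogeneous wt P (μ : ℤ)) (hd : P.IsHomogeneous n) :
    eval axisPt P = coeff (tri μ 0 (n - μ)) P := by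
  rw [eval_axisPt hw hd, axisExp, Int.toNat_natCast]

/-- Jet lemma, negative weight: `P(1,0,1) = 0`. -/
theorem eval_axisPt_neg {P : CPoly} {μ : ℤ} {n : ℕ} (hw : IsWeightedHomogeneous wt P μ) (hd : P.IsHomogeneous n) (hμ : μ < 0) :
    eval axisPt P = 0 := by
  rw [eval_axisPt hw hd]
  refine hw.coeff_eq_zero _ ?_
  rw [weight_wt, axisExp_zero, axisExp_one]
  have : μ.toNat = 0 := Int.toNat_eq_zero.mpr hμ.le
  rw [this]
  push_cast
  omega

/-- Second coefficients through two partial derivatives. [folklore] -/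
theorem coeff_pderiv_pderiv (i j : Fin 3) (P : CPoly) (m : Fin 3 →₀ ℕ) :
    coeff m (pderiv i (pderiv j P))
      = coeff (m + single i 1 + single j 1) P * (((m + single i 1 : Fin 3 →₀ ℕ) j : ℂ) + 1) * ((m i : ℂ) + 1) := by
  rw [coeff_pderiv, coeff_pderiv]

/-- Partial derivatives commute. [folklore] -/
theorem pderiv_comm (i j : Fin 3) (P : CPoly) : pderiv i (pderiv j P) = pderiv j (pderiv i P) := by
  classical
  ext m
  simp only [coeff_pderiv]
  by_cases hij : i = j
  · subst hij; rfl
  · have h1 : (m + Finsupp.single i 1 : Fin 3 →₀ ℕ) j = m j := by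
      rw [Finsupp.add_apply, Finsupp.single_apply, if_neg hij, add_zero]
    have h2 : (m + Finsupp.single j 1 : Fin 3 →₀ ℕ) i = m i := by
      rw [Finsupp.add_apply, Finsupp.single_apply, if_neg (Ne.symm hij), add_zero]
    rw [h1, h2, add_right_comm]
    ring


/-! ### Homogeneity (total degree) bookkeeping -/

section Degrees

variable {A B : CPoly} {m n : ℕ}

/-- `Λ` preserves the total degree. [folklore] -/
theorem isHomogeneous_lam (hA : A.IsHomogeneous m) : (lam A).IsHomogeneous m := by
  unfold lam
  rcases Nat.eq_zero_or_pos m with rfl | hm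
  · -- degree 0: both derivatives vanish? we only need the homogeneity statement; use the general one with `m - 1 + 1`
    have h0 : (X 0 * pderiv 0 A : CPoly).IsHomogeneous (1 + (0 - 1)) := (isHomogeneous_X ℂ 0).mul hA.pderiv
    have h1 : (X 1 * pderiv 1 A : CPoly).IsHomogeneous (1 + (0 - 1)) := (isHomogeneous_X ℂ 1).mul hA.pderiv
    -- `1 + (0 - 1) = 1 ≠ 0`: but then both products are homogeneous of degree 1 AND (being derivatives of a constant) zero
    have hA0 : pderiv 0 A = 0 := by
      rw [← totalDegree_zero_iff_isHomogeneous, totalDegree_eq_zero_iff_eq_C] at hA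
      rw [hA, pderiv_C]
    have hA1 : pderiv 1 A = 0 := by
      rw [← totalDegree_zero_iff_isHomogeneous, totalDegree_eq_zero_iff_eq_C] at hA
      rw [hA, pderiv_C]
    rw [hA0, hA1, mul_zero, mul_zero, sub_zero]
    exact isHomogeneous_zero _ _ _
  · have h0 : (X 0 * pderiv 0 A : CPoly).IsHomogeneous (1 + (m - 1)) := (isHomogeneous_X ℂ 0).mul hA.pderiv
    have h1 : (X 1 * pderiv 1 A : CPoly).IsHomogeneous (1 + (m - 1)) := (isHomogeneous_X ℂ 1).mul hA.pderiv
    have hm' : 1 + (m - 1) = m := by omega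
    rw [hm'] at h0 h1
    exact h0.sub h1

/-- Degree bookkeeping for `dotC`: `(m − 1) + (n − 1)`. [folklore] -/
theorem isHomogeneous_dotC (hA : A.IsHomogeneous m) (hB : B.IsHomogeneous n) :
    (dotC A B).IsHomogeneous (m - 1 + (n - 1)) := by
  unfold dotC
  refine IsHomogeneous.add (IsHomogeneous.C_mul (IsHomogeneous.add ?_ ?_) _) ?_
  · exact hA.pderiv.mul hB.pderiv
  · exact hA.pderiv.mul hB.pderiv
  · exact hA.pderiv.mul hB.pderiv

/-- Degree bookkeeping for `tripleC`: `m + n − 1` (`m, n ≥ 1`). [folklore] -/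
theorem isHomogeneous_tripleC (hA : A.IsHomogeneous m) (hB : B.IsHomogeneous n) (hm : 1 ≤ m) (hn : 1 ≤ n) :
    (tripleC A B).IsHomogeneous (m + n - 1) := by
  unfold tripleC
  have e1 : n - 1 + m = m + n - 1 := by omega
  have e2 : m - 1 + n = m + n - 1 := by omega
  have e3 : 0 + 1 + (m - 1 + (n - 1)) = m + n - 1 := by omega
  refine IsHomogeneous.add (IsHomogeneous.sub ?_ ?_) ?_
  · simpa [e1] using hB.pderiv.mul (isHomogeneous_lam hA)
  · simpa [e2] using hA.pderiv.mul (isHomogeneous_lam hB)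
  · have hC : (C (2 : ℂ) * X 2 : CPoly).IsHomogeneous (0 + 1) := (isHomogeneous_C (σ := Fin 3) (2 : ℂ)).mul (isHomogeneous_X ℂ 2)
    have hin : (pderiv 1 A * pderiv 0 B - pderiv 0 A * pderiv 1 B : CPoly).IsHomogeneous (m - 1 + (n - 1)) :=
      ((hA.pderiv (i := 1)).mul (hB.pderiv (i := 0))).sub ((hA.pderiv (i := 0)).mul (hB.pderiv (i := 1)))
    simpa [e3, mul_assoc] using hC.mul hin

/-- Degree bookkeeping for `D̃`: `3m − 3` (`m ≥ 2`). [folklore] -/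
theorem isHomogeneous_detC (hA : A.IsHomogeneous m) (hm : 2 ≤ m) : (detC A).IsHomogeneous (3 * m - 3) := by
  unfold detC
  have h := isHomogeneous_tripleC hA (isHomogeneous_dotC hA hA) (by omega) (by omega)
  have e : m + (m - 1 + (m - 1)) - 1 = 3 * m - 3 := by omega
  rw [e] at h
  exact h

end Degrees

end Summit.NavierStokesRegularity.NavierStokesRegularity.Theorems.PoloidalLiouville.HorizonTower.Zonal

end
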